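/-
Copyright (c) 2026 the pub-hodgecm-mathlib formalisation cell (harness21).  Prover seat hodgecm-mathlib-K2E1b-p01 (g3), Track B «K2-LIT» ∕ h413
(`stmt-HodgeConjecture-24833`), line `K2_E3_EllipticInputs`, unit U3, line U3-d (lead K2E3-p03): FILE C rung C2 — the REGULAR unipotent class, part (ii)-a:
the centraliser of a regular unipotent element in coordinates.  2026-09-03.
-/
import Summits.HodgeConjecture.HodgeConjecture.Theorems.K2E3UnipotentOrbitalScalingRegular   -- ★ C2-a∕ED. 2 (this seat): §1 nilpotency kit, Ψ-free (i′), `isUnit_det_add_one_of_isNilpotent`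
import HarnessLib

/-!
# K2_E3 road (h413 = stmt-HodgeConjecture-24833), U3-d FILE C, rung C2 «REGULAR UNIPOTENT CLASS» — part (ii)-a: THE CENTRALISER OF A REGULAR UNIPOTENT
# ELEMENT OF `U(σ, J)(K)` IS THE UNITARY PART OF THE COMMUTATIVE ALGEBRA `K[X]`, AND A NORMALISING CONJUGATOR ACTS ON IT BY THE WEIGHTS `(1, s, s²)`

Cell `pub/hodgecm-mathlib` (D-0151), Track B; line lead K2E3-p03 (g0) (ROAD ADOPTED 2026-09-03T23:00Z; letters 23:06Z); dealer K2E3-plan (g1).  Pure linear algebra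
over a field `K` (involution `σ` for §2–§3), no topology.  §1 **(R1)** the commutant of a regular nilpotent `3 × 3` matrix `X` (`X³ = 0 ≠ X²`) is `span{1, X, X²}`
(cyclic vector `(v, Xv, X²v)` + `Basis.ext`), with unique coefficients.  §2 **(R2)** for `X` skew (`ᵗ(σX)·J = −J·X`), `J` invertible: `a·1 + b·X + c·X²` is
`σ`-unitary iff `σa·a = 1`, `σa·b = σb·a`, `σa·c + σc·a = σb·b`.  §3 **`exists_centralizer_coords`**: for a regular unipotent `u₀ ∈ U(σ, J)(K)` there are
homomorphisms `α : Z(u₀) → Kˣ`, `Θ = (β, ζ) : Z(u₀) → (K × K, +)` (`β = b∕a`, `ζ = 2c∕a − β²`) with `mat z = α·(1 + β·X + ((ζ + β²)∕2)·X²)`, `σα·α = 1`, `σβ = β`,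
`σζ = −ζ`, every such triple occurring, and — the point of rung C2 (ii) — **every `h` with `Ad(h)X = s·X` acts on `Z(u₀)` by the WEIGHT MAP `(α, β, ζ) ↦
(α, sβ, s²ζ)`** (★ C2-a `conj_one_add_smul_add_smul_sq`); part (ii)-b (`K2E3UnipotentOrbitalScalingRegularIndex`) counts the index of this map on a box.

THEOREMS ONLY (no definition ∕ instance ∕ notation ∕ named fact ∕ `sorry`).  HONEST LABEL: HC_CM is proved only modulo the 7 printed citations (2 remaining named
inputs: hLiu418 = stmt-HodgeConjecture-24832, h413 = stmt-HodgeConjecture-24833) until rung 0 closes; count-neutral helper of the U3-d line.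

## References
* [HarishChandra1999AdmissibleDistributions] Harish-Chandra, *Admissible Invariant Distributions on Reductive p-adic Groups*, ULS 16 (1999), §3.1 Lemma 3.2.
* [Rogawski1990] J. D. Rogawski, *Automorphic Representations of Unitary Groups in Three Variables* (1990), §3.9 p. 32, §8.1 Prop. 8.1.2 (b) p. 114.
* [SpringerSteinberg1970] T. A. Springer, R. Steinberg, *Conjugacy classes*, in: Seminar on Algebraic Groups and Related Finite Groups, LNM 131 (1970),
  Part III §1 (regular elements: the centraliser of a regular nilpotent∕unipotent and the algebra it generates).
-/

set_option autoImplicit false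
-- the mandated namespace repeats the single-problem summit's segment (`HodgeConjecture.HodgeConjecture`), as in every `Theorems/*.lean` of this sub-problem
set_option linter.dupNamespace false

noncomputable section
open scoped Matrix MatrixGroups
open Literature.NumberTheory.Automorphic Literature.NumberTheory.Automorphic.UnitaryGroup Literature.NumberTheory.Weil1982.UnitaryFinTopForm
open Summit.HodgeConjecture.HodgeConjecture.Cruxes.H413.K2E3CayleyScalingAlgebra
open Summit.HodgeConjecture.HodgeConjecture.Cruxes.H413.K2E3UnipotentOrbitalScalingRegular

namespace Summit.HodgeConjecture.HodgeConjecture.Cruxes.H413.K2E3UnipotentOrbitalScalingRegularCentralizer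

/-! ## §1 (R1) The commutant of a regular nilpotent `3 × 3` matrix -/

section Commutant
variable {K : Type*} [Field K]

/-- **A cyclic vector**: for `X ∈ M₃(K)` with `X³ = 0 ≠ X²` there is `v` with `X²v ≠ 0`, and then `(v, Xv, X²v)` is linearly independent (apply `X²`, then
`X`, to a vanishing combination). [cite: SpringerSteinberg1970, III §1 (regular elements and their centralisers)] -/
theorem exists_cyclicVector {X : Matrix (Fin 3) (Fin 3) K} (hX3 : X * X * X = 0) (hX2 : X * X ≠ 0) :
    ∃ v : Fin 3 → K, (X * X) *ᵥ v ≠ 0 ∧ LinearIndependent K ![v, X *ᵥ v, (X * X) *ᵥ v] := by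
  classical
  obtain ⟨v, hv⟩ : ∃ v : Fin 3 → K, (X * X) *ᵥ v ≠ 0 := by
    by_contra h; push Not at h
    exact hX2 ((LinearEquiv.map_eq_zero_iff Matrix.toLin').1 (LinearMap.ext fun w => by rw [Matrix.toLin'_apply, h w, LinearMap.zero_apply]))
  have hX3v : (X * X * X) *ᵥ v = 0 := by rw [hX3, Matrix.zero_mulVec]
  have hX4 : X * X * (X * X) = 0 := by rw [← Matrix.mul_assoc, hX3, Matrix.zero_mul]
  have hX4v : (X * X * (X * X)) *ᵥ v = 0 := by rw [hX4, Matrix.zero_mulVec]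
  have hX3v' : (X * (X * X)) *ᵥ v = 0 := by rw [← Matrix.mul_assoc, hX3, Matrix.zero_mulVec]
  refine ⟨v, hv, Fintype.linearIndependent_iff.2 fun g hg => ?_⟩
  simp only [Fin.sum_univ_three, Matrix.cons_val_zero, Matrix.cons_val_one, Matrix.cons_val_two, Matrix.head_cons, Matrix.tail_cons] at hg
  have h0 : g 0 = 0 := by  -- apply `X²`: `g 0 • X²v = 0`
    have h := congrArg (fun u => (X * X) *ᵥ u) hg
    simp only [Matrix.mulVec_add, Matrix.mulVec_smul, Matrix.mulVec_mulVec, Matrix.mulVec_zero, hX3v, hX4v, smul_zero, add_zero] at h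
    exact (smul_eq_zero.1 h).resolve_right hv
  rw [h0, zero_smul, zero_add] at hg
  have h1 : g 1 = 0 := by  -- apply `X`: `g 1 • X²v = 0`
    have h := congrArg (fun u => X *ᵥ u) hg
    simp only [Matrix.mulVec_add, Matrix.mulVec_smul, Matrix.mulVec_mulVec, Matrix.mulVec_zero, hX3v', smul_zero, add_zero] at h
    exact (smul_eq_zero.1 h).resolve_right hv
  rw [h1, zero_smul, zero_add] at hg
  have h2 : g 2 = 0 := (smul_eq_zero.1 hg).resolve_right hv
  intro i; fin_cases i <;> assumption

/-- **(R1) THE COMMUTANT OF A REGULAR NILPOTENT `3 × 3` MATRIX IS `K[X] = span{1, X, X²}`**: if `X³ = 0 ≠ X²` and `XZ = ZX` then `Z = a·1 + b·X + c·X²`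
(`Z` and the polynomial agree on the cyclic basis `(v, Xv, X²v)`). [cite: SpringerSteinberg1970, III §1 (regular elements and their centralisers)] [cite: Rogawski1990, §3.9 p. 32] -/
theorem exists_eq_smul_one_add_of_comm {X Z : Matrix (Fin 3) (Fin 3) K} (hX3 : X * X * X = 0) (hX2 : X * X ≠ 0) (hc : X * Z = Z * X) :
    ∃ a b c : K, Z = a • (1 : Matrix (Fin 3) (Fin 3) K) + b • X + c • (X * X) := by
  classical
  obtain ⟨v, hv, hli⟩ := exists_cyclicVector hX3 hX2
  let bas : Module.Basis (Fin 3) K (Fin 3 → K) := basisOfLinearIndependentOfCardEqFinrank hli (by simp)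
  have hbas : ⇑bas = ![v, X *ᵥ v, (X * X) *ᵥ v] := coe_basisOfLinearIndependentOfCardEqFinrank hli _
  -- coordinates of `Z v`
  obtain ⟨a, b, c, hZv⟩ : ∃ a b c : K, Z *ᵥ v = a • v + b • (X *ᵥ v) + c • ((X * X) *ᵥ v) := by
    refine ⟨bas.repr (Z *ᵥ v) 0, bas.repr (Z *ᵥ v) 1, bas.repr (Z *ᵥ v) 2, ?_⟩
    have h := bas.sum_repr (Z *ᵥ v); rw [Fin.sum_univ_three, hbas] at h
    simpa only [Matrix.cons_val_zero, Matrix.cons_val_one, Matrix.cons_val_two, Matrix.head_cons, Matrix.tail_cons] using h.symm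
  refine ⟨a, b, c, ?_⟩
  -- the polynomial `P` commutes with `X` and agrees with `Z` on `v`
  have hPX : X * (a • (1 : Matrix (Fin 3) (Fin 3) K) + b • X + c • (X * X)) = (a • (1 : Matrix (Fin 3) (Fin 3) K) + b • X + c • (X * X)) * X := by
    simp only [Matrix.mul_add, Matrix.add_mul, Matrix.mul_smul, Matrix.smul_mul, Matrix.mul_one, Matrix.one_mul, Matrix.mul_assoc]
  have hPv : (a • (1 : Matrix (Fin 3) (Fin 3) K) + b • X + c • (X * X)) *ᵥ v = Z *ᵥ v := by
    rw [hZv, Matrix.add_mulVec, Matrix.add_mulVec, Matrix.smul_mulVec, Matrix.smul_mulVec, Matrix.smul_mulVec, Matrix.one_mulVec]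
  -- `Z (M v) = P (M v)` for `M ∈ {1, X, X²}` (both commute with `M`)
  have key : ∀ M : Matrix (Fin 3) (Fin 3) K, Z * M = M * Z → (a • (1 : Matrix (Fin 3) (Fin 3) K) + b • X + c • (X * X)) * M = M * (a • 1 + b • X + c • (X * X)) →
      Z *ᵥ (M *ᵥ v) = (a • (1 : Matrix (Fin 3) (Fin 3) K) + b • X + c • (X * X)) *ᵥ (M *ᵥ v) := by
    intro M hZM hPM
    rw [Matrix.mulVec_mulVec, Matrix.mulVec_mulVec, hZM, hPM, ← Matrix.mulVec_mulVec, ← Matrix.mulVec_mulVec, hPv]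
  have hZX : Z * X = X * Z := hc.symm
  have hZXX : Z * (X * X) = X * X * Z := by rw [← Matrix.mul_assoc, hZX, Matrix.mul_assoc, hZX, ← Matrix.mul_assoc]
  have hPXX : (a • (1 : Matrix (Fin 3) (Fin 3) K) + b • X + c • (X * X)) * (X * X) = X * X * (a • 1 + b • X + c • (X * X)) := by
    rw [← Matrix.mul_assoc, ← hPX, Matrix.mul_assoc, ← hPX, ← Matrix.mul_assoc]
  refine Matrix.toLin'.injective (bas.ext fun i => ?_)
  rw [Matrix.toLin'_apply, Matrix.toLin'_apply, hbas]; fin_cases i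
  · change Z *ᵥ v = (a • (1 : Matrix (Fin 3) (Fin 3) K) + b • X + c • (X * X)) *ᵥ v
    simpa only [Matrix.one_mulVec] using key 1 (by rw [Matrix.mul_one, Matrix.one_mul]) (by rw [Matrix.mul_one, Matrix.one_mul])
  · change Z *ᵥ (X *ᵥ v) = (a • (1 : Matrix (Fin 3) (Fin 3) K) + b • X + c • (X * X)) *ᵥ (X *ᵥ v)
    exact key X hZX hPX.symm
  · change Z *ᵥ ((X * X) *ᵥ v) = (a • (1 : Matrix (Fin 3) (Fin 3) K) + b • X + c • (X * X)) *ᵥ ((X * X) *ᵥ v)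
    exact key (X * X) hZXX hPXX

/-- **Uniqueness of the coefficients**: `a·1 + b·X + c·X² = 0` forces `a = b = c = 0` when `X³ = 0 ≠ X²` (apply to a cyclic vector). [cite: SpringerSteinberg1970, III §1 (regular elements and their centralisers)] -/
theorem smul_one_add_eq_zero {X : Matrix (Fin 3) (Fin 3) K} (hX3 : X * X * X = 0) (hX2 : X * X ≠ 0) {a b c : K}
    (h : a • (1 : Matrix (Fin 3) (Fin 3) K) + b • X + c • (X * X) = 0) : a = 0 ∧ b = 0 ∧ c = 0 := by
  obtain ⟨v, -, hli⟩ := exists_cyclicVector hX3 hX2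
  have hv : a • v + b • (X *ᵥ v) + c • ((X * X) *ᵥ v) = 0 := by
    have h' := congrArg (fun M : Matrix (Fin 3) (Fin 3) K => M *ᵥ v) h
    simpa only [Matrix.add_mulVec, Matrix.smul_mulVec, Matrix.one_mulVec, Matrix.zero_mulVec] using h'
  have key := (Fintype.linearIndependent_iff.1 hli) ![a, b, c] (by
    simpa only [Fin.sum_univ_three, Matrix.cons_val_zero, Matrix.cons_val_one, Matrix.cons_val_two, Matrix.head_cons, Matrix.tail_cons] using hv)
  exact ⟨by simpa using key 0, by simpa using key 1, by simpa using key 2⟩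

/-- **Comparison of coefficients** in `K[X]`, `X³ = 0 ≠ X²`. [cite: SpringerSteinberg1970, III §1 (regular elements and their centralisers)] -/
theorem coeff_unique {X : Matrix (Fin 3) (Fin 3) K} (hX3 : X * X * X = 0) (hX2 : X * X ≠ 0) {a b c a' b' c' : K}
    (h : a • (1 : Matrix (Fin 3) (Fin 3) K) + b • X + c • (X * X) = a' • (1 : Matrix (Fin 3) (Fin 3) K) + b' • X + c' • (X * X)) :
    a = a' ∧ b = b' ∧ c = c' := by
  have h0 : (a - a') • (1 : Matrix (Fin 3) (Fin 3) K) + (b - b') • X + (c - c') • (X * X) = 0 := by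
    rw [sub_smul, sub_smul, sub_smul, ← sub_eq_zero.2 h]; abel
  obtain ⟨ha, hb, hc⟩ := smul_one_add_eq_zero hX3 hX2 h0
  exact ⟨sub_eq_zero.1 ha, sub_eq_zero.1 hb, sub_eq_zero.1 hc⟩

/-- **Products in `K[X]`** (`X³ = 0`): `(a + bX + cX²)(a′ + b′X + c′X²) = aa′ + (ab′ + ba′)X + (ac′ + bb′ + ca′)X²`. [cite: SpringerSteinberg1970, III §1 (regular elements and their centralisers)] -/
theorem smul_one_add_mul {X : Matrix (Fin 3) (Fin 3) K} (hX3 : X * X * X = 0) (a b c a' b' c' : K) :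
    (a • (1 : Matrix (Fin 3) (Fin 3) K) + b • X + c • (X * X)) * (a' • (1 : Matrix (Fin 3) (Fin 3) K) + b' • X + c' • (X * X)) =
      (a * a') • (1 : Matrix (Fin 3) (Fin 3) K) + (a * b' + b * a') • X + (a * c' + b * b' + c * a') • (X * X) := by
  have hX4 : X * X * (X * X) = 0 := by rw [← Matrix.mul_assoc, hX3, Matrix.zero_mul]
  have hX3' : X * (X * X) = 0 := by rw [← Matrix.mul_assoc, hX3]
  simp only [Matrix.mul_add, Matrix.add_mul, Matrix.mul_smul, Matrix.smul_mul, Matrix.mul_one, Matrix.one_mul, hX3, hX3', hX4, smul_zero, add_zero,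
    smul_smul]
  module

end Commutant

/-! ## §2 (R2) The unitary members of `K[X]` for a skew `X` -/

section Unitary
variable {K : Type*} [Field K] (σ : K →+* K)

/-- `(a • M).map σ = σ a • M.map σ` for a ring homomorphism `σ`. [folklore] -/
theorem map_smul_eq (a : K) (M : Matrix (Fin 3) (Fin 3) K) : (a • M).map σ = σ a • M.map σ := by
  ext i j
  simp only [Matrix.map_apply, Matrix.smul_apply, smul_eq_mul, map_mul]

/-- **The adjoint of a polynomial in a skew `X`**: if `ᵗ(σX)·J = −J·X` then `ᵗσ(a·1 + b·X + c·X²)·J = J·(σa·1 − σb·X + σc·X²)`.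
[cite: HarishChandra1999AdmissibleDistributions, §3.1 Lemma 3.2] -/
theorem transpose_map_smul_one_add_mul (J : Matrix (Fin 3) (Fin 3) K) {X : Matrix (Fin 3) (Fin 3) K} (hskew : (X.map σ)ᵀ * J + J * X = 0) (a b c : K) :
    ((a • (1 : Matrix (Fin 3) (Fin 3) K) + b • X + c • (X * X)).map σ)ᵀ * J = J * (σ a • (1 : Matrix (Fin 3) (Fin 3) K) - σ b • X + σ c • (X * X)) := by
  have hXJ : (X.map σ)ᵀ * J = -(J * X) := eq_neg_of_add_eq_zero_left hskew
  have hXXJ : (X.map σ)ᵀ * (X.map σ)ᵀ * J = J * (X * X) := by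
    rw [Matrix.mul_assoc, hXJ, Matrix.mul_neg, ← Matrix.mul_assoc, hXJ, Matrix.neg_mul, neg_neg, Matrix.mul_assoc]
  rw [Matrix.map_add σ (map_add σ), Matrix.map_add σ (map_add σ), map_smul_eq, map_smul_eq, map_smul_eq, Matrix.map_mul, Matrix.map_one _ (map_zero σ) (map_one σ),
    Matrix.transpose_add, Matrix.transpose_add, Matrix.transpose_smul, Matrix.transpose_smul, Matrix.transpose_smul, Matrix.transpose_one,
    Matrix.transpose_mul, Matrix.add_mul, Matrix.add_mul, Matrix.smul_mul, Matrix.smul_mul, Matrix.smul_mul, Matrix.one_mul, hXJ, hXXJ,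
    Matrix.mul_add, Matrix.mul_sub, Matrix.mul_smul, Matrix.mul_smul, Matrix.mul_smul, Matrix.mul_one, smul_neg, sub_eq_add_neg]

/-- **(R2) THE UNITARY MEMBERS OF `K[X]`**: for `X` skew with `X³ = 0 ≠ X²` and `J` invertible, `g = a·1 + b·X + c·X²` satisfies `ᵗ(σg)·J·g = J` iff
`σa·a = 1 ∧ σa·b = σb·a ∧ σa·c + σc·a = σb·b` (expand in `K[X]` and compare coefficients). [cite: Rogawski1990, §3.9 p. 32]
[cite: HarishChandra1999AdmissibleDistributions, §3.1 Lemma 3.2] -/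
theorem unitary_smul_one_add_iff {J X : Matrix (Fin 3) (Fin 3) K} (hJ : IsUnit J.det) (hskew : (X.map σ)ᵀ * J + J * X = 0)
    (hX3 : X * X * X = 0) (hX2 : X * X ≠ 0) (a b c : K) :
    ((a • (1 : Matrix (Fin 3) (Fin 3) K) + b • X + c • (X * X)).map σ)ᵀ * J * (a • (1 : Matrix (Fin 3) (Fin 3) K) + b • X + c • (X * X)) = J ↔
      σ a * a = 1 ∧ σ a * b = σ b * a ∧ σ a * c + σ c * a = σ b * b := by
  have hprod : (σ a • (1 : Matrix (Fin 3) (Fin 3) K) - σ b • X + σ c • (X * X)) * (a • (1 : Matrix (Fin 3) (Fin 3) K) + b • X + c • (X * X)) =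
      (σ a * a) • (1 : Matrix (Fin 3) (Fin 3) K) + (σ a * b - σ b * a) • X + (σ a * c - σ b * b + σ c * a) • (X * X) := by
    have h := smul_one_add_mul hX3 (σ a) (-σ b) (σ c) a b c
    rw [neg_smul, ← sub_eq_add_neg] at h; rw [h]; congr 2 <;> ring_nf
  rw [transpose_map_smul_one_add_mul σ J hskew, Matrix.mul_assoc, hprod]
  constructor
  · intro h  -- `J * Q = J = J * 1` with `J` invertible ⇒ `Q = 1`
    have hQ : (σ a * a) • (1 : Matrix (Fin 3) (Fin 3) K) + (σ a * b - σ b * a) • X + (σ a * c - σ b * b + σ c * a) • (X * X) =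
        (1 : K) • (1 : Matrix (Fin 3) (Fin 3) K) + (0 : K) • X + (0 : K) • (X * X) := by
      have h1 : J⁻¹ * J = 1 := Matrix.nonsing_inv_mul _ hJ; have h' := congrArg (fun M => J⁻¹ * M) h
      simp only [← Matrix.mul_assoc, h1, Matrix.one_mul] at h'
      rw [h', one_smul, zero_smul, zero_smul, add_zero, add_zero]
    obtain ⟨h₁, h₂, h₃⟩ := coeff_unique hX3 hX2 hQ
    exact ⟨h₁, sub_eq_zero.1 h₂, by linear_combination h₃⟩
  · rintro ⟨h₁, h₂, h₃⟩
    rw [h₁, sub_eq_zero.2 h₂, show σ a * c - σ b * b + σ c * a = 0 by linear_combination h₃, one_smul, zero_smul, zero_smul, add_zero, add_zero,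
      Matrix.mul_one]

/-- **Normalised coordinates**: under `σa·a = 1` (so `a ≠ 0`), the unitarity relations say `σ(b∕a) = b∕a` and `c∕a + σ(c∕a) = (b∕a)²`.
[cite: Rogawski1990, §3.9 p. 32] -/
theorem fixed_div_and_trace_div_of_unitary {a b c : K} (h₁ : σ a * a = 1) (h₂ : σ a * b = σ b * a) (h₃ : σ a * c + σ c * a = σ b * b) :
    σ (b / a) = b / a ∧ c / a + σ (c / a) = (b / a) ^ 2 := by
  have ha : a ≠ 0 := fun h => by rw [h, mul_zero] at h₁; exact zero_ne_one h₁
  have hσa : σ a ≠ 0 := fun h => by rw [h, zero_mul] at h₁; exact zero_ne_one h₁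
  have hai : a⁻¹ = σ a := (eq_inv_of_mul_eq_one_left h₁).symm
  have hsai : (σ a)⁻¹ = a := inv_eq_of_mul_eq_one_right h₁
  have hσb : σ b = σ a * b * σ a := by
    calc σ b = σ b * a * a⁻¹ := by rw [mul_inv_cancel_right₀ ha]
      _ = σ a * b * σ a := by rw [← h₂, hai]
  constructor
  · rw [map_div₀, div_eq_div_iff hσa ha, mul_comm b (σ a)]
    exact h₂.symm
  · rw [map_div₀, div_eq_mul_inv, div_eq_mul_inv, div_eq_mul_inv, hsai, hai]
    calc c * σ a + σ c * a = σ a * c + σ c * a := by ring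
      _ = σ b * b := h₃
      _ = (b * σ a) ^ 2 := by rw [hσb]; ring

end Unitary

/-! ## §3 The centraliser of a regular unipotent `u₀ ∈ U(σ, J)(K)` in coordinates: the homomorphisms `α : Z(u₀) → Kˣ` and `Θ : Z(u₀) → (K × K, +)` -/

section Group

variable {K : Type*} [Field K] (σ : K →+* K) {J : Matrix (Fin 3) (Fin 3) K}

/-- `X_g³ = 0` for `g` with `(g − 1)³ = 0` (`X_g = (g − 1)(g + 1)⁻¹` with commuting factors). [cite: PlatonovRapinchuk1994, §3.3] -/
theorem inverseWindow_mul_self_mul_self_eq_zero {g : Matrix (Fin 3) (Fin 3) K} (hP : IsUnit (g + 1).det) (h3 : (g - 1) ^ 3 = 0) :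
    (g - 1) * (g + 1)⁻¹ * ((g - 1) * (g + 1)⁻¹) * ((g - 1) * (g + 1)⁻¹) = 0 := by
  have hc : (g + 1) * (g - 1) = (g - 1) * (g + 1) := by noncomm_ring
  have hi : (g + 1)⁻¹ * (g - 1) = (g - 1) * (g + 1)⁻¹ := nonsing_inv_comm_of_comm hP hc
  have h3' : (g - 1) * (g - 1) * (g - 1) = 0 := by rw [← h3]; noncomm_ring
  calc (g - 1) * (g + 1)⁻¹ * ((g - 1) * (g + 1)⁻¹) * ((g - 1) * (g + 1)⁻¹)
      = (g - 1) * ((g + 1)⁻¹ * (g - 1)) * ((g + 1)⁻¹ * (g - 1)) * (g + 1)⁻¹ := by simp only [Matrix.mul_assoc]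
    _ = (g - 1) * ((g - 1) * (g + 1)⁻¹) * ((g - 1) * (g + 1)⁻¹) * (g + 1)⁻¹ := by rw [hi]
    _ = (g - 1) * (g - 1) * ((g + 1)⁻¹ * (g - 1)) * (g + 1)⁻¹ * (g + 1)⁻¹ := by simp only [Matrix.mul_assoc]
    _ = (g - 1) * (g - 1) * ((g - 1) * (g + 1)⁻¹) * (g + 1)⁻¹ * (g + 1)⁻¹ := by rw [hi]
    _ = (g - 1) * (g - 1) * (g - 1) * (g + 1)⁻¹ * (g + 1)⁻¹ * (g + 1)⁻¹ := by simp only [Matrix.mul_assoc]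
    _ = 0 := by rw [h3', Matrix.zero_mul, Matrix.zero_mul, Matrix.zero_mul]

set_option maxHeartbeats 1600000 in
-- one large existential package (two homomorphisms + four properties); the coefficient bookkeeping exceeds the default budget
/-- **THE CENTRALISER OF A REGULAR UNIPOTENT `u₀ ∈ U(σ, J)(K)` IN COORDINATES.**  (`2 ≠ 0`, `J` invertible, `(mat u₀ − 1)³ = 0 ≠ (mat u₀ − 1)²`, `X = X_{u₀}`.)
There are homomorphisms `α : Z(u₀) → Kˣ` and `Θ = (β, ζ) : Z(u₀) → (K × K, +)` with
(1) `mat z = α(z)·(1 + β·X + ((ζ + β²)∕2)·X²)` (so `(α, Θ)` is injective);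
(2) `σα·α = 1`, `σβ = β`, `σζ = −ζ`;
(3) every such triple `(a, β, ζ)` occurs;
(4) for every `h ∈ U(σ, J)` with `Ad(h) X = s·X`: `h Z(u₀) h⁻¹ = Z(u₀)` elementwise with `α(hzh⁻¹) = α(z)` and `Θ(hzh⁻¹) = (sβ, s²ζ)` — the WEIGHT MAP.
(`Z(u₀)` is the unitary part of the commutative algebra `K[X]`, §1–§2; `ζ = 2γ − β²` linearises the law `(β, γ)(β′, γ′) = (β + β′, γ + γ′ + ββ′)` with no division by `2`.)
[cite: Rogawski1990, §3.9 p. 32; §8.1 Prop. 8.1.2 (b) p. 114] [cite: HarishChandra1999AdmissibleDistributions, §3.1 Lemma 3.2] [cite: SpringerSteinberg1970, III §1 (regular elements and their centralisers)] -/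
theorem exists_centralizer_coords (hJ : IsUnit J.det) (h2 : (2 : K) ≠ 0) (u₀ : ↥(unitaryGroupOfForm σ J))
    (h3 : (((u₀ : GL (Fin 3) K) : Matrix (Fin 3) (Fin 3) K) - 1) ^ 3 = 0) (hreg : (((u₀ : GL (Fin 3) K) : Matrix (Fin 3) (Fin 3) K) - 1) ^ 2 ≠ 0) :
    ∃ (α : ↥(Subgroup.centralizer ({u₀} : Set ↥(unitaryGroupOfForm σ J))) →* Kˣ) (Θ : ↥(Subgroup.centralizer ({u₀} : Set ↥(unitaryGroupOfForm σ J))) →* Multiplicative (K × K)),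
      (∀ z : ↥(Subgroup.centralizer ({u₀} : Set ↥(unitaryGroupOfForm σ J))), (((z : ↥(unitaryGroupOfForm σ J)) : GL (Fin 3) K) : Matrix (Fin 3) (Fin 3) K) =
        (α z : K) • ((1 : Matrix (Fin 3) (Fin 3) K) + (Θ z).toAdd.1 • ((((u₀ : GL (Fin 3) K) : Matrix (Fin 3) (Fin 3) K) - 1) * (((u₀ : GL (Fin 3) K) : Matrix (Fin 3) (Fin 3) K) + 1)⁻¹) + (((Θ z).toAdd.2 + (Θ z).toAdd.1 ^ 2) / 2) • (((((u₀ : GL (Fin 3) K) : Matrix (Fin 3) (Fin 3) K) - 1) * (((u₀ : GL (Fin 3) K) : Matrix (Fin 3) (Fin 3) K) + 1)⁻¹) * ((((u₀ : GL (Fin 3) K) : Matrix (Fin 3) (Fin 3) K) - 1) * (((u₀ : GL (Fin 3) K) : Matrix (Fin 3) (Fin 3) K) + 1)⁻¹)))) ∧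
      (∀ z : ↥(Subgroup.centralizer ({u₀} : Set ↥(unitaryGroupOfForm σ J))), σ (α z : K) * (α z : K) = 1 ∧ σ (Θ z).toAdd.1 = (Θ z).toAdd.1 ∧ σ (Θ z).toAdd.2 = -(Θ z).toAdd.2) ∧
      (∀ a β ζ : K, σ a * a = 1 → σ β = β → σ ζ = -ζ → ∃ z : ↥(Subgroup.centralizer ({u₀} : Set ↥(unitaryGroupOfForm σ J))), (α z : K) = a ∧ (Θ z).toAdd = (β, ζ)) ∧
      (∀ (h : ↥(unitaryGroupOfForm σ J)) (s : K), ((h : GL (Fin 3) K) : Matrix (Fin 3) (Fin 3) K) * ((((u₀ : GL (Fin 3) K) : Matrix (Fin 3) (Fin 3) K) - 1) * (((u₀ : GL (Fin 3) K) : Matrix (Fin 3) (Fin 3) K) + 1)⁻¹) * (((h : GL (Fin 3) K)⁻¹ : GL (Fin 3) K) : Matrix (Fin 3) (Fin 3) K) = s • ((((u₀ : GL (Fin 3) K) : Matrix (Fin 3) (Fin 3) K) - 1) * (((u₀ : GL (Fin 3) K) : Matrix (Fin 3) (Fin 3) K) + 1)⁻¹) →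
        ∀ z : ↥(Subgroup.centralizer ({u₀} : Set ↥(unitaryGroupOfForm σ J))), ∃ hz : h * (z : ↥(unitaryGroupOfForm σ J)) * h⁻¹ ∈ Subgroup.centralizer ({u₀} : Set ↥(unitaryGroupOfForm σ J)),
          α ⟨h * (z : ↥(unitaryGroupOfForm σ J)) * h⁻¹, hz⟩ = α z ∧ (Θ ⟨h * (z : ↥(unitaryGroupOfForm σ J)) * h⁻¹, hz⟩).toAdd = (s * (Θ z).toAdd.1, s ^ 2 * (Θ z).toAdd.2)) := by
  classical
  have hnil : IsNilpotent (((u₀ : GL (Fin 3) K) : Matrix (Fin 3) (Fin 3) K) - 1) := ⟨3, h3⟩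
  have hreg' : (((u₀ : GL (Fin 3) K) : Matrix (Fin 3) (Fin 3) K) - 1) * (((u₀ : GL (Fin 3) K) : Matrix (Fin 3) (Fin 3) K) - 1) ≠ 0 := by rwa [← sq]
  have hP : IsUnit (((u₀ : GL (Fin 3) K) : Matrix (Fin 3) (Fin 3) K) + 1).det := isUnit_det_add_one_of_isNilpotent h2 hnil
  have hX3 : ((((u₀ : GL (Fin 3) K) : Matrix (Fin 3) (Fin 3) K) - 1) * (((u₀ : GL (Fin 3) K) : Matrix (Fin 3) (Fin 3) K) + 1)⁻¹) * ((((u₀ : GL (Fin 3) K) : Matrix (Fin 3) (Fin 3) K) - 1) * (((u₀ : GL (Fin 3) K) : Matrix (Fin 3) (Fin 3) K) + 1)⁻¹) * ((((u₀ : GL (Fin 3) K) : Matrix (Fin 3) (Fin 3) K) - 1) * (((u₀ : GL (Fin 3) K) : Matrix (Fin 3) (Fin 3) K) + 1)⁻¹) = 0 := inverseWindow_mul_self_mul_self_eq_zero hP h3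
  have hX2 : ((((u₀ : GL (Fin 3) K) : Matrix (Fin 3) (Fin 3) K) - 1) * (((u₀ : GL (Fin 3) K) : Matrix (Fin 3) (Fin 3) K) + 1)⁻¹) * ((((u₀ : GL (Fin 3) K) : Matrix (Fin 3) (Fin 3) K) - 1) * (((u₀ : GL (Fin 3) K) : Matrix (Fin 3) (Fin 3) K) + 1)⁻¹) ≠ 0 := inverseWindow_sq_ne_zero hP hreg'
  have hskew : (((((u₀ : GL (Fin 3) K) : Matrix (Fin 3) (Fin 3) K) - 1) * (((u₀ : GL (Fin 3) K) : Matrix (Fin 3) (Fin 3) K) + 1)⁻¹).map σ)ᵀ * J + J * ((((u₀ : GL (Fin 3) K) : Matrix (Fin 3) (Fin 3) K) - 1) * (((u₀ : GL (Fin 3) K) : Matrix (Fin 3) (Fin 3) K) + 1)⁻¹) = 0 := transpose_map_inverseWindow_add_eq_zero σ (mem_unitaryGroupOfForm_iff.1 u₀.2) hP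
  -- every `z ∈ Z(u₀)` is a polynomial in `X` with unitary coefficients
  have hcomm : ∀ z : ↥(Subgroup.centralizer ({u₀} : Set ↥(unitaryGroupOfForm σ J))), ((((u₀ : GL (Fin 3) K) : Matrix (Fin 3) (Fin 3) K) - 1) * (((u₀ : GL (Fin 3) K) : Matrix (Fin 3) (Fin 3) K) + 1)⁻¹) * (((z : ↥(unitaryGroupOfForm σ J)) : GL (Fin 3) K) : Matrix (Fin 3) (Fin 3) K) = (((z : ↥(unitaryGroupOfForm σ J)) : GL (Fin 3) K) : Matrix (Fin 3) (Fin 3) K) * ((((u₀ : GL (Fin 3) K) : Matrix (Fin 3) (Fin 3) K) - 1) * (((u₀ : GL (Fin 3) K) : Matrix (Fin 3) (Fin 3) K) + 1)⁻¹) := by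
    intro z
    have hzu : (z : ↥(unitaryGroupOfForm σ J)) * u₀ = u₀ * (z : ↥(unitaryGroupOfForm σ J)) := Subgroup.mem_centralizer_singleton_iff.1 z.2
    exact inverseWindow_comm_of_comm hP ((commute_iff_coe_coe σ (z : ↥(unitaryGroupOfForm σ J)) u₀).1 hzu).symm
  choose fa fb fc hf using fun z : ↥(Subgroup.centralizer ({u₀} : Set ↥(unitaryGroupOfForm σ J))) => exists_eq_smul_one_add_of_comm hX3 hX2 (hcomm z)
  have hunit : ∀ z : ↥(Subgroup.centralizer ({u₀} : Set ↥(unitaryGroupOfForm σ J))), σ (fa z) * fa z = 1 ∧ σ (fa z) * fb z = σ (fb z) * fa z ∧ σ (fa z) * fc z + σ (fc z) * fa z = σ (fb z) * fb z := by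
    intro z
    have hU := mem_unitaryGroupOfForm_iff.1 (z : ↥(unitaryGroupOfForm σ J)).2
    rw [hf z] at hU
    exact (unitary_smul_one_add_iff σ hJ hskew hX3 hX2 _ _ _).1 hU
  have ha0 : ∀ z : ↥(Subgroup.centralizer ({u₀} : Set ↥(unitaryGroupOfForm σ J))), fa z ≠ 0 := fun z h => by have := (hunit z).1; rw [h, mul_zero] at this; exact zero_ne_one this
  have hmul : ∀ z z' : ↥(Subgroup.centralizer ({u₀} : Set ↥(unitaryGroupOfForm σ J))), fa (z * z') = fa z * fa z' ∧ fb (z * z') = fa z * fb z' + fb z * fa z' ∧ fc (z * z') = fa z * fc z' + fb z * fb z' + fc z * fa z' := by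
    intro z z'; have h := hf (z * z')
    have hzz : ((((z * z' : ↥(Subgroup.centralizer ({u₀} : Set ↥(unitaryGroupOfForm σ J)))) : ↥(unitaryGroupOfForm σ J)) : GL (Fin 3) K) : Matrix (Fin 3) (Fin 3) K) =
        (((z : ↥(unitaryGroupOfForm σ J)) : GL (Fin 3) K) : Matrix (Fin 3) (Fin 3) K) * (((z' : ↥(unitaryGroupOfForm σ J)) : GL (Fin 3) K) : Matrix (Fin 3) (Fin 3) K) := by
      simp only [Subgroup.coe_mul, Units.val_mul]
    rw [hzz, hf z, hf z', smul_one_add_mul hX3] at h; exact coeff_unique hX3 hX2 h.symm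
  have hone : fa 1 = 1 ∧ fb 1 = 0 ∧ fc 1 = 0 := by
    have h := hf 1
    have h1 : ((((1 : ↥(Subgroup.centralizer ({u₀} : Set ↥(unitaryGroupOfForm σ J)))) : ↥(unitaryGroupOfForm σ J)) : GL (Fin 3) K) : Matrix (Fin 3) (Fin 3) K) = (1 : K) • (1 : Matrix (Fin 3) (Fin 3) K) + (0 : K) • ((((u₀ : GL (Fin 3) K) : Matrix (Fin 3) (Fin 3) K) - 1) * (((u₀ : GL (Fin 3) K) : Matrix (Fin 3) (Fin 3) K) + 1)⁻¹) + (0 : K) • (((((u₀ : GL (Fin 3) K) : Matrix (Fin 3) (Fin 3) K) - 1) * (((u₀ : GL (Fin 3) K) : Matrix (Fin 3) (Fin 3) K) + 1)⁻¹) * ((((u₀ : GL (Fin 3) K) : Matrix (Fin 3) (Fin 3) K) - 1) * (((u₀ : GL (Fin 3) K) : Matrix (Fin 3) (Fin 3) K) + 1)⁻¹)) := by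
      rw [one_smul, zero_smul, zero_smul, add_zero, add_zero]; rfl
    rw [h1] at h; obtain ⟨h₁, h₂, h₃⟩ := coeff_unique hX3 hX2 h; exact ⟨h₁.symm, h₂.symm, h₃.symm⟩
  -- `fa•1 + fb•X + fc•X² = fa•(1 + (fb/fa)•X + (fc/fa)•X²)`
  have hnorm : ∀ z : ↥(Subgroup.centralizer ({u₀} : Set ↥(unitaryGroupOfForm σ J))), (((z : ↥(unitaryGroupOfForm σ J)) : GL (Fin 3) K) : Matrix (Fin 3) (Fin 3) K) =
      fa z • ((1 : Matrix (Fin 3) (Fin 3) K) + (fb z / fa z) • ((((u₀ : GL (Fin 3) K) : Matrix (Fin 3) (Fin 3) K) - 1) * (((u₀ : GL (Fin 3) K) : Matrix (Fin 3) (Fin 3) K) + 1)⁻¹) + (fc z / fa z) • (((((u₀ : GL (Fin 3) K) : Matrix (Fin 3) (Fin 3) K) - 1) * (((u₀ : GL (Fin 3) K) : Matrix (Fin 3) (Fin 3) K) + 1)⁻¹) * ((((u₀ : GL (Fin 3) K) : Matrix (Fin 3) (Fin 3) K) - 1) * (((u₀ : GL (Fin 3) K) : Matrix (Fin 3) (Fin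 3) K) + 1)⁻¹))) := by
    intro z
    rw [hf z, smul_add, smul_add, smul_smul, smul_smul, mul_div_cancel₀ _ (ha0 z), mul_div_cancel₀ _ (ha0 z)]
  -- the homomorphisms
  refine ⟨{ toFun := fun z => Units.mk0 (fa z) (ha0 z)
            map_one' := Units.ext (by simp [hone.1])
            map_mul' := fun z z' => Units.ext (by simp [(hmul z z').1]) },
          { toFun := fun z => Multiplicative.ofAdd (fb z / fa z, 2 * (fc z / fa z) - (fb z / fa z) ^ 2)
            map_one' := by simp [hone.1, hone.2.1, hone.2.2]
            map_mul' := fun z z' => ?_ }, ?_, ?_, ?_, ?_⟩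
  · -- additivity of `(β, ζ)`
    rw [← ofAdd_add, Prod.mk_add_mk]
    obtain ⟨hma, hmb, hmc⟩ := hmul z z'; have ha := ha0 z; have ha' := ha0 z'
    congr 1; refine Prod.ext ?_ ?_
    · simp only [hmb, hma]; field_simp; ring
    · simp only [hmc, hmb, hma]; field_simp; ring
  · -- (1) reconstruction
    intro z
    have e : (2 * (fc z / fa z) - (fb z / fa z) ^ 2 + (fb z / fa z) ^ 2) / 2 = fc z / fa z := by
      rw [sub_add_cancel, mul_div_cancel_left₀ _ h2]
    simp only [MonoidHom.coe_mk, OneHom.coe_mk, Units.val_mk0, toAdd_ofAdd, e]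
    exact hnorm z
  · -- (2) constraints
    intro z
    simp only [MonoidHom.coe_mk, OneHom.coe_mk, Units.val_mk0, toAdd_ofAdd]
    obtain ⟨h₁, h₂, h₃⟩ := hunit z; obtain ⟨hβ, hγ⟩ := fixed_div_and_trace_div_of_unitary σ h₁ h₂ h₃
    refine ⟨h₁, hβ, ?_⟩
    rw [map_sub, map_mul, map_pow, hβ, map_ofNat]; linear_combination 2 * hγ
  · -- (3) surjectivity: `P = a(1 + βX + (ζ + β²/2)X²)` is unitary, invertible and commutes with `u₀`
    intro a β ζ ha hβ hζ
    have ha0' : a ≠ 0 := fun h => by rw [h, mul_zero] at ha; exact zero_ne_one ha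
    have hU : ((a • (1 : Matrix (Fin 3) (Fin 3) K) + (a * β) • ((((u₀ : GL (Fin 3) K) : Matrix (Fin 3) (Fin 3) K) - 1) * (((u₀ : GL (Fin 3) K) : Matrix (Fin 3) (Fin 3) K) + 1)⁻¹) + (a * ((ζ + β ^ 2) / 2)) • (((((u₀ : GL (Fin 3) K) : Matrix (Fin 3) (Fin 3) K) - 1) * (((u₀ : GL (Fin 3) K) : Matrix (Fin 3) (Fin 3) K) + 1)⁻¹) * ((((u₀ : GL (Fin 3) K) : Matrix (Fin 3) (Fin 3) K) - 1) * (((u₀ : GL (Fin 3) K) : Matrix (Fin 3) (Fin 3) K) + 1)⁻¹))).map σ)ᵀ * J *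
        (a • (1 : Matrix (Fin 3) (Fin 3) K) + (a * β) • ((((u₀ : GL (Fin 3) K) : Matrix (Fin 3) (Fin 3) K) - 1) * (((u₀ : GL (Fin 3) K) : Matrix (Fin 3) (Fin 3) K) + 1)⁻¹) + (a * ((ζ + β ^ 2) / 2)) • (((((u₀ : GL (Fin 3) K) : Matrix (Fin 3) (Fin 3) K) - 1) * (((u₀ : GL (Fin 3) K) : Matrix (Fin 3) (Fin 3) K) + 1)⁻¹) * ((((u₀ : GL (Fin 3) K) : Matrix (Fin 3) (Fin 3) K) - 1) * (((u₀ : GL (Fin 3) K) : Matrix (Fin 3) (Fin 3) K) + 1)⁻¹))) = J := by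
      refine (unitary_smul_one_add_iff σ hJ hskew hX3 hX2 _ _ _).2 ⟨ha, ?_, ?_⟩
      · rw [map_mul, hβ]; ring
      · have hσa : σ a = a⁻¹ := eq_inv_of_mul_eq_one_left ha
        rw [map_mul, map_div₀, map_add, hζ, map_pow, hβ, map_ofNat, map_mul, hβ, hσa]
        field_simp; ring
    have hdetP : IsUnit (a • (1 : Matrix (Fin 3) (Fin 3) K) + (a * β) • ((((u₀ : GL (Fin 3) K) : Matrix (Fin 3) (Fin 3) K) - 1) * (((u₀ : GL (Fin 3) K) : Matrix (Fin 3) (Fin 3) K) + 1)⁻¹) + (a * ((ζ + β ^ 2) / 2)) • (((((u₀ : GL (Fin 3) K) : Matrix (Fin 3) (Fin 3) K) - 1) * (((u₀ : GL (Fin 3) K) : Matrix (Fin 3) (Fin 3) K) + 1)⁻¹) * ((((u₀ : GL (Fin 3) K) : Matrix (Fin 3) (Fin 3) K) - 1) * (((u₀ : GL (Fin 3) K) : Matrix (Fin 3) (Fin 3) K) + 1)⁻¹))).det := by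
      have h := congrArg Matrix.det hU; rw [Matrix.det_mul, Matrix.det_mul] at h
      have h' : J.det * ((a • (1 : Matrix (Fin 3) (Fin 3) K) + (a * β) • ((((u₀ : GL (Fin 3) K) : Matrix (Fin 3) (Fin 3) K) - 1) * (((u₀ : GL (Fin 3) K) : Matrix (Fin 3) (Fin 3) K) + 1)⁻¹) + (a * ((ζ + β ^ 2) / 2)) • (((((u₀ : GL (Fin 3) K) : Matrix (Fin 3) (Fin 3) K) - 1) * (((u₀ : GL (Fin 3) K) : Matrix (Fin 3) (Fin 3) K) + 1)⁻¹) * ((((u₀ : GL (Fin 3) K) : Matrix (Fin 3) (Fin 3) K) - 1) * (((u₀ : GL (Fin 3) K) : Matrix (Fin 3) (Fin 3) K) + 1)⁻¹))).det *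
          (((a • (1 : Matrix (Fin 3) (Fin 3) K) + (a * β) • ((((u₀ : GL (Fin 3) K) : Matrix (Fin 3) (Fin 3) K) - 1) * (((u₀ : GL (Fin 3) K) : Matrix (Fin 3) (Fin 3) K) + 1)⁻¹) + (a * ((ζ + β ^ 2) / 2)) • (((((u₀ : GL (Fin 3) K) : Matrix (Fin 3) (Fin 3) K) - 1) * (((u₀ : GL (Fin 3) K) : Matrix (Fin 3) (Fin 3) K) + 1)⁻¹) * ((((u₀ : GL (Fin 3) K) : Matrix (Fin 3) (Fin 3) K) - 1) * (((u₀ : GL (Fin 3) K) : Matrix (Fin 3) (Fin 3) K) + 1)⁻¹))).map σ)ᵀ).det) = J.det * 1 := by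
        rw [mul_one]; linear_combination h
      exact IsUnit.of_mul_eq_one _ (hJ.mul_left_cancel h')
    have hPunit : IsUnit (a • (1 : Matrix (Fin 3) (Fin 3) K) + (a * β) • ((((u₀ : GL (Fin 3) K) : Matrix (Fin 3) (Fin 3) K) - 1) * (((u₀ : GL (Fin 3) K) : Matrix (Fin 3) (Fin 3) K) + 1)⁻¹) + (a * ((ζ + β ^ 2) / 2)) • (((((u₀ : GL (Fin 3) K) : Matrix (Fin 3) (Fin 3) K) - 1) * (((u₀ : GL (Fin 3) K) : Matrix (Fin 3) (Fin 3) K) + 1)⁻¹) * ((((u₀ : GL (Fin 3) K) : Matrix (Fin 3) (Fin 3) K) - 1) * (((u₀ : GL (Fin 3) K) : Matrix (Fin 3) (Fin 3) K) + 1)⁻¹))) :=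
      (Matrix.isUnit_iff_isUnit_det _).2 hdetP
    have hmem : hPunit.unit ∈ unitaryGroupOfForm σ J := by
      rw [mem_unitaryGroupOfForm_iff, IsUnit.unit_spec]; exact hU
    have hXg : ((((u₀ : GL (Fin 3) K) : Matrix (Fin 3) (Fin 3) K) - 1) * (((u₀ : GL (Fin 3) K) : Matrix (Fin 3) (Fin 3) K) + 1)⁻¹) * ((u₀ : GL (Fin 3) K) : Matrix (Fin 3) (Fin 3) K) = ((u₀ : GL (Fin 3) K) : Matrix (Fin 3) (Fin 3) K) * ((((u₀ : GL (Fin 3) K) : Matrix (Fin 3) (Fin 3) K) - 1) * (((u₀ : GL (Fin 3) K) : Matrix (Fin 3) (Fin 3) K) + 1)⁻¹) := inverseWindow_comm_of_comm hP rfl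
    have hPg : (a • (1 : Matrix (Fin 3) (Fin 3) K) + (a * β) • ((((u₀ : GL (Fin 3) K) : Matrix (Fin 3) (Fin 3) K) - 1) * (((u₀ : GL (Fin 3) K) : Matrix (Fin 3) (Fin 3) K) + 1)⁻¹) + (a * ((ζ + β ^ 2) / 2)) • (((((u₀ : GL (Fin 3) K) : Matrix (Fin 3) (Fin 3) K) - 1) * (((u₀ : GL (Fin 3) K) : Matrix (Fin 3) (Fin 3) K) + 1)⁻¹) * ((((u₀ : GL (Fin 3) K) : Matrix (Fin 3) (Fin 3) K) - 1) * (((u₀ : GL (Fin 3) K) : Matrix (Fin 3) (Fin 3) K) + 1)⁻¹))) * ((u₀ : GL (Fin 3) K) : Matrix (Fin 3) (Fin 3) K) =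
        ((u₀ : GL (Fin 3) K) : Matrix (Fin 3) (Fin 3) K) * (a • (1 : Matrix (Fin 3) (Fin 3) K) + (a * β) • ((((u₀ : GL (Fin 3) K) : Matrix (Fin 3) (Fin 3) K) - 1) * (((u₀ : GL (Fin 3) K) : Matrix (Fin 3) (Fin 3) K) + 1)⁻¹) + (a * ((ζ + β ^ 2) / 2)) • (((((u₀ : GL (Fin 3) K) : Matrix (Fin 3) (Fin 3) K) - 1) * (((u₀ : GL (Fin 3) K) : Matrix (Fin 3) (Fin 3) K) + 1)⁻¹) * ((((u₀ : GL (Fin 3) K) : Matrix (Fin 3) (Fin 3) K) - 1) * (((u₀ : GL (Fin 3) K) : Matrix (Fin 3) (Fin 3) K) + 1)⁻¹))) := by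
      have hXXg : ((((u₀ : GL (Fin 3) K) : Matrix (Fin 3) (Fin 3) K) - 1) * (((u₀ : GL (Fin 3) K) : Matrix (Fin 3) (Fin 3) K) + 1)⁻¹) * ((((u₀ : GL (Fin 3) K) : Matrix (Fin 3) (Fin 3) K) - 1) * (((u₀ : GL (Fin 3) K) : Matrix (Fin 3) (Fin 3) K) + 1)⁻¹) * ((u₀ : GL (Fin 3) K) : Matrix (Fin 3) (Fin 3) K) = ((u₀ : GL (Fin 3) K) : Matrix (Fin 3) (Fin 3) K) * (((((u₀ : GL (Fin 3) K) : Matrix (Fin 3) (Fin 3) K) - 1) * (((u₀ : GL (Fin 3) K) : Matrix (Fin 3) (Fin 3) K) + 1)⁻¹) * ((((u₀ : GL (Fin 3) K) : Matrix (Fin 3) (Fin 3) K) - 1) * (((u₀ : GL (Fin 3) K) : Matrix (Fin 3) (Fin 3) K) + 1)⁻¹)) := by rw [Matrix.mul_assoc, hXg, ← Matrix.mul_assoc, hXg, Matrix.mul_assoc]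
      simp only [Matrix.add_mul, Matrix.mul_add, Matrix.smul_mul, Matrix.mul_smul, Matrix.one_mul, Matrix.mul_one, hXg, hXXg]
    have hz₀ : (⟨hPunit.unit, hmem⟩ : ↥(unitaryGroupOfForm σ J)) ∈ Subgroup.centralizer ({u₀} : Set ↥(unitaryGroupOfForm σ J)) := by
      rw [Subgroup.mem_centralizer_singleton_iff, commute_iff_coe_coe]
      show (hPunit.unit : Matrix (Fin 3) (Fin 3) K) * ((u₀ : GL (Fin 3) K) : Matrix (Fin 3) (Fin 3) K) = ((u₀ : GL (Fin 3) K) : Matrix (Fin 3) (Fin 3) K) * (hPunit.unit : Matrix (Fin 3) (Fin 3) K)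
      rw [IsUnit.unit_spec]; exact hPg
    refine ⟨⟨⟨hPunit.unit, hmem⟩, hz₀⟩, ?_⟩
    have hcoef := hf ⟨⟨hPunit.unit, hmem⟩, hz₀⟩
    have hval : ((((⟨⟨hPunit.unit, hmem⟩, hz₀⟩ : ↥(Subgroup.centralizer ({u₀} : Set ↥(unitaryGroupOfForm σ J)))) : ↥(unitaryGroupOfForm σ J)) : GL (Fin 3) K) : Matrix (Fin 3) (Fin 3) K) =
        a • (1 : Matrix (Fin 3) (Fin 3) K) + (a * β) • ((((u₀ : GL (Fin 3) K) : Matrix (Fin 3) (Fin 3) K) - 1) * (((u₀ : GL (Fin 3) K) : Matrix (Fin 3) (Fin 3) K) + 1)⁻¹) + (a * ((ζ + β ^ 2) / 2)) • (((((u₀ : GL (Fin 3) K) : Matrix (Fin 3) (Fin 3) K) - 1) * (((u₀ : GL (Fin 3) K) : Matrix (Fin 3) (Fin 3) K) + 1)⁻¹) * ((((u₀ : GL (Fin 3) K) : Matrix (Fin 3) (Fin 3) K) - 1) * (((u₀ : GL (Fin 3) K) : Matrix (Fin 3) (Fin 3) K) + 1)⁻¹)) := IsUnit.unit_spec hPu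nit
    rw [hval] at hcoef
    obtain ⟨h₁, h₂, h₃⟩ := coeff_unique hX3 hX2 hcoef
    simp only [MonoidHom.coe_mk, OneHom.coe_mk, Units.val_mk0, toAdd_ofAdd]
    refine ⟨h₁.symm, Prod.ext ?_ ?_⟩
    · simp only; rw [← h₁, ← h₂]; field_simp
    · simp only; rw [← h₁, ← h₂, ← h₃]; field_simp; ring
  · -- (4) the weight map
    intro h s hAd z
    have h2u : IsUnit (2 : K) := isUnit_iff_ne_zero.2 h2
    have hs0 : s ≠ 0 := by
      rintro rfl; rw [zero_smul] at hAd; apply hX2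
      have hx : (((h : GL (Fin 3) K)⁻¹ : GL (Fin 3) K) : Matrix (Fin 3) (Fin 3) K) * ((h : GL (Fin 3) K) : Matrix (Fin 3) (Fin 3) K) = 1 := by
        rw [← Units.val_mul, inv_mul_cancel, Units.val_one]
      have hX0 : ((((u₀ : GL (Fin 3) K) : Matrix (Fin 3) (Fin 3) K) - 1) * (((u₀ : GL (Fin 3) K) : Matrix (Fin 3) (Fin 3) K) + 1)⁻¹) = 0 := by
        calc ((((u₀ : GL (Fin 3) K) : Matrix (Fin 3) (Fin 3) K) - 1) * (((u₀ : GL (Fin 3) K) : Matrix (Fin 3) (Fin 3) K) + 1)⁻¹) = ((((h : GL (Fin 3) K)⁻¹ : GL (Fin 3) K) : Matrix (Fin 3) (Fin 3) K) * ((h : GL (Fin 3) K) : Matrix (Fin 3) (Fin 3) K)) * ((((u₀ : GL (Fin 3) K) : Matrix (Fin 3) (Fin 3) K) - 1) * (((u₀ : GL (Fin 3) K) : Matrix (Fin 3) (Fin 3) K) + 1)⁻¹) *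
            ((((h : GL (Fin 3) K)⁻¹ : GL (Fin 3) K) : Matrix (Fin 3) (Fin 3) K) * ((h : GL (Fin 3) K) : Matrix (Fin 3) (Fin 3) K)) := by rw [hx, Matrix.one_mul, Matrix.mul_one]
          _ = (((h : GL (Fin 3) K)⁻¹ : GL (Fin 3) K) : Matrix (Fin 3) (Fin 3) K) * (((h : GL (Fin 3) K) : Matrix (Fin 3) (Fin 3) K) * ((((u₀ : GL (Fin 3) K) : Matrix (Fin 3) (Fin 3) K) - 1) * (((u₀ : GL (Fin 3) K) : Matrix (Fin 3) (Fin 3) K) + 1)⁻¹) *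
            (((h : GL (Fin 3) K)⁻¹ : GL (Fin 3) K) : Matrix (Fin 3) (Fin 3) K)) * ((h : GL (Fin 3) K) : Matrix (Fin 3) (Fin 3) K) := by simp only [Matrix.mul_assoc]
          _ = 0 := by rw [hAd, Matrix.mul_zero, Matrix.zero_mul]
      rw [hX0, Matrix.mul_zero]
    -- `mat(h u₀ h⁻¹) = c(s·X)`, so `h z h⁻¹ ∈ Z(u₀)`
    have hci : IsUnit (1 - (((u₀ : GL (Fin 3) K) : Matrix (Fin 3) (Fin 3) K) - 1) * ((((u₀ : GL (Fin 3) K) : Matrix (Fin 3) (Fin 3) K)) + 1)⁻¹).det ∧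
        cayley ((((u₀ : GL (Fin 3) K) : Matrix (Fin 3) (Fin 3) K) - 1) * ((((u₀ : GL (Fin 3) K) : Matrix (Fin 3) (Fin 3) K)) + 1)⁻¹) = ((u₀ : GL (Fin 3) K) : Matrix (Fin 3) (Fin 3) K) :=
      Literature.NumberTheory.Weil1982.UnitaryFinTopForm.cayley_inverseWindow h2u hP
    obtain ⟨hm₀, hcay₀⟩ := hci
    have hmat : (((h * u₀ * h⁻¹ : ↥(unitaryGroupOfForm σ J)) : GL (Fin 3) K) : Matrix (Fin 3) (Fin 3) K) = cayley (s • ((((u₀ : GL (Fin 3) K) : Matrix (Fin 3) (Fin 3) K) - 1) * (((u₀ : GL (Fin 3) K) : Matrix (Fin 3) (Fin 3) K) + 1)⁻¹)) := by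
      rw [← hAd, cayley_conj (h : GL (Fin 3) K) hm₀, hcay₀]
      simp only [Subgroup.coe_mul, Subgroup.coe_inv, Units.val_mul]
    have hz : h * (z : ↥(unitaryGroupOfForm σ J)) * h⁻¹ ∈ Subgroup.centralizer ({u₀} : Set ↥(unitaryGroupOfForm σ J)) :=
      (mem_centralizer_iff_conj_mem_of_coe_conj_eq σ h2 hs0 hnil hmat (z : ↥(unitaryGroupOfForm σ J))).1 z.2
    refine ⟨hz, ?_⟩
    have hval : ((((⟨h * (z : ↥(unitaryGroupOfForm σ J)) * h⁻¹, hz⟩ : ↥(Subgroup.centralizer ({u₀} : Set ↥(unitaryGroupOfForm σ J)))) : ↥(unitaryGroupOfForm σ J)) : GL (Fin 3) K) : Matrix (Fin 3) (Fin 3) K) =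
        ((h : GL (Fin 3) K) : Matrix (Fin 3) (Fin 3) K) * (((z : ↥(unitaryGroupOfForm σ J)) : GL (Fin 3) K) : Matrix (Fin 3) (Fin 3) K) *
          (((h : GL (Fin 3) K)⁻¹ : GL (Fin 3) K) : Matrix (Fin 3) (Fin 3) K) := by
      show (((h * (z : ↥(unitaryGroupOfForm σ J)) * h⁻¹ : ↥(unitaryGroupOfForm σ J)) : GL (Fin 3) K) : Matrix (Fin 3) (Fin 3) K) = _
      simp only [Subgroup.coe_mul, Subgroup.coe_inv, Units.val_mul]
    have hconjz : ((h : GL (Fin 3) K) : Matrix (Fin 3) (Fin 3) K) * (((z : ↥(unitaryGroupOfForm σ J)) : GL (Fin 3) K) : Matrix (Fin 3) (Fin 3) K) *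
          (((h : GL (Fin 3) K)⁻¹ : GL (Fin 3) K) : Matrix (Fin 3) (Fin 3) K) =
        fa z • (1 : Matrix (Fin 3) (Fin 3) K) + (fa z * (s * (fb z / fa z))) • ((((u₀ : GL (Fin 3) K) : Matrix (Fin 3) (Fin 3) K) - 1) * (((u₀ : GL (Fin 3) K) : Matrix (Fin 3) (Fin 3) K) + 1)⁻¹) + (fa z * (s ^ 2 * (fc z / fa z))) • (((((u₀ : GL (Fin 3) K) : Matrix (Fin 3) (Fin 3) K) - 1) * (((u₀ : GL (Fin 3) K) : Matrix (Fin 3) (Fin 3) K) + 1)⁻¹) * ((((u₀ : GL (Fin 3) K) : Matrix (Fin 3) (Fin 3) K) - 1) * (((u₀ : GL (Fin 3) K) : Matrix (Fin 3) (Fin 3) K) + 1)⁻¹)) := by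
      rw [hnorm z, conj_one_add_smul_add_smul_sq (h : GL (Fin 3) K) hAd (fa z) (fb z / fa z) (fc z / fa z), smul_add, smul_add, smul_smul, smul_smul]
    have hcz : fa z • (1 : Matrix (Fin 3) (Fin 3) K) + (fa z * (s * (fb z / fa z))) • ((((u₀ : GL (Fin 3) K) : Matrix (Fin 3) (Fin 3) K) - 1) * (((u₀ : GL (Fin 3) K) : Matrix (Fin 3) (Fin 3) K) + 1)⁻¹) + (fa z * (s ^ 2 * (fc z / fa z))) • (((((u₀ : GL (Fin 3) K) : Matrix (Fin 3) (Fin 3) K) - 1) * (((u₀ : GL (Fin 3) K) : Matrix (Fin 3) (Fin 3) K) + 1)⁻¹) * ((((u₀ : GL (Fin 3) K) : Matrix (Fin 3) (Fin 3) K) - 1) * (((u₀ : GL (Fin 3) K) : Matrix (Fin 3) (Fin 3) K) + 1)⁻¹)) =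
        fa ⟨h * (z : ↥(unitaryGroupOfForm σ J)) * h⁻¹, hz⟩ • (1 : Matrix (Fin 3) (Fin 3) K) + fb ⟨h * (z : ↥(unitaryGroupOfForm σ J)) * h⁻¹, hz⟩ • ((((u₀ : GL (Fin 3) K) : Matrix (Fin 3) (Fin 3) K) - 1) * (((u₀ : GL (Fin 3) K) : Matrix (Fin 3) (Fin 3) K) + 1)⁻¹) +
          fc ⟨h * (z : ↥(unitaryGroupOfForm σ J)) * h⁻¹, hz⟩ • (((((u₀ : GL (Fin 3) K) : Matrix (Fin 3) (Fin 3) K) - 1) * (((u₀ : GL (Fin 3) K) : Matrix (Fin 3) (Fin 3) K) + 1)⁻¹) * ((((u₀ : GL (Fin 3) K) : Matrix (Fin 3) (Fin 3) K) - 1) * (((u₀ : GL (Fin 3) K) : Matrix (Fin 3) (Fin 3) K) + 1)⁻¹)) := by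
      rw [← hconjz, ← hval]; exact hf ⟨h * (z : ↥(unitaryGroupOfForm σ J)) * h⁻¹, hz⟩
    obtain ⟨h₁, h₂, h₃⟩ := coeff_unique hX3 hX2 hcz
    have ha := ha0 z
    simp only [MonoidHom.coe_mk, OneHom.coe_mk, toAdd_ofAdd]
    refine ⟨Units.ext (by simp only [Units.val_mk0]; exact h₁.symm), Prod.ext ?_ ?_⟩
    · simp only; rw [← h₁, ← h₂]; field_simp
    · simp only; rw [← h₁, ← h₂, ← h₃]; field_simp

end Group
end Summit.HodgeConjecture.HodgeConjecture.Cruxes.H413.K2E3UnipotentOrbitalScalingRegularCentralizer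

end
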